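import Mathlib
import Literature.Analysis.ODE.LoopSlavingEstimate
import Summits.AtomisticToContinuum.HydrodynamicLimit.Theorems.ImplosionDichotomyDenseExcursionSonicSlavingWedgeContinuation
import Summits.AtomisticToContinuum.HydrodynamicLimit.Theorems.ImplosionDichotomyDenseExcursionSonicSlavingPathGauge
import Summits.AtomisticToContinuum.HydrodynamicLimit.Theorems.ImplosionDichotomyDenseExcursionSonicSlavingContourCoeff
import Summits.AtomisticToContinuum.HydrodynamicLimit.Theorems.ImplosionDichotomyDenseExcursionSonicSlavingLoopPath
import Summits.AtomisticToContinuum.HydrodynamicLimit.Theorems.ImplosionDichotomyDenseExcursionSonicSlavingConj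
import Summits.AtomisticToContinuum.HydrodynamicLimit.Theorems.ImplosionDichotomyDenseExcursionSonicCentreContentRealThree

/-!
# Sonic slaving by contour transport: `SonicSlaving` from the cavity tube, the wedge continuation and the loop clause
# (crux `DenseExcursion`, line `sonic-cavity-renewal` v7 → v8, the registered stub `stub_sonicSlaving` modulo the new data clause)

Helper file (`--supports stmt-AtomisticToContinuum-12586`, line lead a2, stub-worker A (wave 3) for `stub_sonicSlaving`).

`sonicSlaving_of_wedgeLoop` (the main theorem; the registered helper of this file is `contour_constants`): for a monatomic profile in the pinned window with the cavity tube, a holomorphic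
continuation `Wc, Sc` of `W, S` to the sonic wedge (the qualitative part of `CavityTubeWedge`: holomorphy, real traces, `c₋ ≠ 0`,
`c₊` vanishing only at the sonic point) and the LOOP CLAUSE of the worker report `work/stubs/A_sonicSlaving.REPORT.md` §3 (sup bounds
(L) on the sub-wedge, the vertical-leg inequalities (V), and the tangent triple on the twelve edges of the contour of
`…SonicSlavingLoopPath`), the sonic-slaving inequality `SonicSlaving r W S` holds: for every smooth radial mode with
`−1/4 < Re Λ ≤ boxSide`, `|Im Λ| > boxTop`, `|Im Λ|·‖D(x_m)‖ ≤ 2‖m(x_m)‖`. Proof = the contour-transport architecture: reduce to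
`Im Λ > 1000` (`sonicSlaving_of_pos_im`), `Re Λ ≤ 3` (`realBound_three`); continue the mode to the wedge
(`smoothMode_wedge_continuation`); pull the slaved gauge back along the closed contour (`exists_sonicLoop`, `path_slaved_gauge`, phase =
ray primitive of `(Λ − b₋₋)/c₋`); verify the pointwise hypotheses from the clause (`contour_pointwise`, `…_vertical`); apply the
Literature loop estimate `loop_slaving_estimate`; identify the base values with `pWaveContent` and `m(x_m)`; arithmetic of the
constants (`λ = 1598`, `L₀ = 1598·η_m ≈ 151`, `f₁ = (25/4)/Im Λ`, `Φ = Φ′ = (25/2)/Im Λ`, `A_α = 8/5`, `ϱ = 400/(127 Im Λ)`: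
`Im Λ·c₁/(1 − κ) ≤ 1/100 ≪ 2`). No citation is load-bearing.
-/

noncomputable section

open Set Filter MeasureTheory intervalIntegral Complex
open scoped Topology

namespace Summit.AtomisticToContinuum.HydrodynamicLimit.Theorems.SonicCavityRenewal

open Summit.AtomisticToContinuum.HydrodynamicLimit.Theorems.R2OneModeTwoConditions

/-! ## The constants -/

/-- `e^{−151} ≤ 10⁻⁴` (crudely, from `x²/2 ≤ eˣ`). [folklore] -/
theorem exp_neg_L0_le : Real.exp (-(1598 * (189 / 2000))) ≤ 1 / 10000 := by
  have h := Real.pow_div_factorial_le_exp (x := (1598 * (189 / 2000) : ℝ)) (by norm_num) 2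
  rw [Real.exp_neg, inv_eq_one_div, div_le_div_iff₀ (Real.exp_pos _) (by norm_num), one_mul]
  have : (10000 : ℝ) ≤ (1598 * (189 / 2000) : ℝ) ^ 2 / (2 : ℕ).factorial := by norm_num [Nat.factorial]
  linarith

/-- **The constants of the loop estimate close with margin**: for `Im Λ ≥ 1000`, with `e = e^{−L₀}`, `c₁ = (f₁/λ + eΦ)/(1 − e)`,
`κ = A_α(c₁ + Φ′ + ϱ)` as in `loop_slaving_estimate` (`λ = 1598`, `f₁ = (25/4)/Im Λ`, `Φ = Φ′ = (25/2)/Im Λ`, `A_α = 8/5`,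
`ϱ = 400/(127 Im Λ)`): `0 < 1 − κ` and `Im Λ·c₁ ≤ 2(1 − κ)`. [folklore] -/
theorem contour_constants : ∀ (L : ℝ), 1000 ≤ L → 0 < 1 - 8 / 5 * ((25 / 4 / L / 1598 + Real.exp (-(1598 * (189 / 2000))) * (25 / 2 / L)) / (1 - Real.exp (-(1598 * (189 / 2000)))) + 25 / 2 / L + 400 / (127 * L)) ∧ L * ((25 / 4 / L / 1598 + Real.exp (-(1598 * (189 / 2000))) * (25 / 2 / L)) / (1 - Real.exp (-(1598 * (189 / 2000))))) ≤ 2 * (1 - 8 / 5 * ((25 / 4 / L / 1598 + Real.exp (-(1598 * (189 / 2000))) * (25 / 2 / L)) / (1 - Real.exp (-(1598 * (189 / 2000)))) + 25 / 2 / L + 400 / (127 * L))) := by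
  intro L hL
  set e : ℝ := Real.exp (-(1598 * (189 / 2000))) with he
  have he0 : 0 < e := Real.exp_pos _
  have he1 : e ≤ 1 / 10000 := exp_neg_L0_le
  have hL0 : 0 < L := by linarith
  -- `c₁ ≤ 1/(100 L)`
  have hc1 : (25 / 4 / L / 1598 + e * (25 / 2 / L)) / (1 - e) ≤ 1 / (100 * L) := by
    rw [div_le_div_iff₀ (by linarith) (by positivity)]
    have h1 : 25 / 4 / L / 1598 ≤ 1 / (250 * L) := by
      rw [div_div, div_le_div_iff₀ (by positivity) (by positivity)]; nlinarith
    have h2 : e * (25 / 2 / L) ≤ 1 / (800 * L) := by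
      rw [← mul_div_assoc, div_le_div_iff₀ hL0 (by positivity)]; nlinarith
    have h3 : (1 / (250 * L) + 1 / (800 * L)) * (100 * L) ≤ 1 * (1 - e) := by
      field_simp; nlinarith
    nlinarith [mul_le_mul_of_nonneg_right (add_le_add h1 h2) (by positivity : (0 : ℝ) ≤ 100 * L)]
  have hc0 : 0 ≤ (25 / 4 / L / 1598 + e * (25 / 2 / L)) / (1 - e) := by
    apply div_nonneg (by positivity); linarith
  -- `κ ≤ 1/10`
  have hκ : 8 / 5 * ((25 / 4 / L / 1598 + e * (25 / 2 / L)) / (1 - e) + 25 / 2 / L + 400 / (127 * L)) ≤ 1 / 10 := by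
    have h1 : 25 / 2 / L ≤ 25 / 2 / 1000 := div_le_div_of_nonneg_left (by norm_num) (by norm_num) hL
    have h2 : 400 / (127 * L) ≤ 400 / (127 * 1000) := div_le_div_of_nonneg_left (by norm_num) (by norm_num) (by nlinarith)
    have h3 : 1 / (100 * L) ≤ 1 / (100 * 1000) := div_le_div_of_nonneg_left (by norm_num) (by norm_num) (by nlinarith)
    nlinarith
  constructor
  · linarith
  · have : L * ((25 / 4 / L / 1598 + e * (25 / 2 / L)) / (1 - e)) ≤ L * (1 / (100 * L)) := mul_le_mul_of_nonneg_left hc1 hL0.le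
    have h2 : L * (1 / (100 * L)) = 1 / 100 := by field_simp
    nlinarith


/-! ## The theorem -/

/-- **SONIC SLAVING BY CONTOUR TRANSPORT** — `sonicSlaving_of_wedgeLoop`, the v8 form of `stub_sonicSlaving` (the stub follows by
unpacking the proposed clause `CavityTubeWedgeLoop`, a three-line bridge). See the module docstring for the architecture. [folklore] -/
theorem sonicSlaving_of_wedgeLoop : ∀ (r : ℝ) (W S : ℝ → ℝ) (Wc Sc : ℂ → ℂ) (A : Fin 13 → ℂ), (17307 / 15625 : ℝ) ≤ r → r ≤ 697 / 625 → IsMonatomicProfile r W S → CavityTube r W S → DifferentiableOn ℂ Wc sonicWedge → DifferentiableOn ℂ Sc sonicWedge → (∀ x : ℝ, -(4 / 5 : ℝ) < x → x < 1 / 20 → Wc x = W x ∧ Sc x = S x) → (∀ z ∈ sonicWedge, 1 ≤ ‖Wc z - 1 - Sc z‖) → (∀ z ∈ sonicWedge, 3 / 10 * ‖z‖ ≤ ‖Wc z - 1 + Sc z‖) → A = ![((-(7 / 10 : ℝ)) : ℂ), ((-(7 / 10 : ℝ)) : ℂ) - (189 / 2000 : ℝ) * Complex.I, ((-(1 / 25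 : ℝ)) : ℂ) - (27 / 5000 : ℝ) * Complex.I, ((-(3 / 100 : ℝ)) : ℂ) - (3 / 100 : ℝ) * Complex.I, -((1 / 25 : ℝ) : ℂ) * Complex.I, ((3 / 100 : ℝ) : ℂ) - (3 / 100 : ℝ) * Complex.I, ((1 / 25 : ℝ) : ℂ), ((3 / 100 : ℝ) : ℂ) + (3 / 100 : ℝ) * Complex.I, ((1 / 25 : ℝ) : ℂ) * Complex.I, ((-(3 / 100 : ℝ)) : ℂ) + (3 / 100 : ℝ) * Complex.I, ((-(1 / 25 : ℝ)) : ℂ) + (27 / 5000 : ℝ) * Complex.I, ((-(7 / 10 : ℝ)) : ℂ) + (189 / 2000 : ℝ) * Complex.I, ((-(7 / 10 : ℝ)) : ℂ)] → (∀ z : ℂ, ((-(7 / 10 : ℝ) ≤ z.re ∧ z.re ≤ 0 ∧ |z.im| ≤ 27 / 200 * |z.re|) ∨ ‖z‖ ≤ 9 / 200) → (‖(deriv Wc z / 3 - deriv Sc z - 2 * Sc z) / (Wc z - 1 - Sc z)‖ ≤ 4 / 5 ∧ ‖(deriv Wc z / 3 + deriv Sc z + 2 * Sc z)‖ ≤ 2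 ∧ ‖(deriv (deriv Wc) z / 3 + deriv (deriv Sc) z + 2 * deriv Sc z)‖ ≤ 2 ∧ ‖((Wc z - 1 + Sc z) / (Wc z - 1 - Sc z))‖ ≤ 9 / 25 ∧ ‖((deriv Wc z + deriv Sc z) / (Wc z - 1 - Sc z) - (Wc z - 1 + Sc z) * (deriv Wc z - deriv Sc z) / (Wc z - 1 - Sc z) ^ 2)‖ ≤ 3 / 5 ∧ ‖(2 / 3 * deriv Wc z + 2 * Wc z - r + 2 * deriv Sc z + 4 * Sc z)‖ ≤ 3 ∧ ‖(2 / 3 * deriv Wc z + 2 * Wc z - r - 2 * deriv Sc z - 4 * Sc z)‖ ≤ 5 ∧ ‖(2 / 3 * deriv (deriv Wc) z + 2 * deriv Wc z + 2 * deriv (deriv Sc) z + 4 * deriv Sc z)‖ ≤ 4 ∧ ‖(2 / 3 * deriv (deriv Wc) z + 2 * deriv Wc z - 2 * deriv (deriv Sc) z - 4 * deriv Sc z)‖ ≤ 4)) → (∀ η : ℝ, |η| ≤ 189 / 2000 → 8 / 5 ≤ ((1 / (Wc (((-(7 / 10 : ℝ)) : ℂ) + (η : ℂ) * Complex.I) -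 1 + Sc (((-(7 / 10 : ℝ)) : ℂ) + (η : ℂ) * Complex.I)) - 1 / (Wc (((-(7 / 10 : ℝ)) : ℂ) + (η : ℂ) * Complex.I) - 1 - Sc (((-(7 / 10 : ℝ)) : ℂ) + (η : ℂ) * Complex.I)))).re ∧ |((1 / (Wc (((-(7 / 10 : ℝ)) : ℂ) + (η : ℂ) * Complex.I) - 1 + Sc (((-(7 / 10 : ℝ)) : ℂ) + (η : ℂ) * Complex.I)) - 1 / (Wc (((-(7 / 10 : ℝ)) : ℂ) + (η : ℂ) * Complex.I) - 1 - Sc (((-(7 / 10 : ℝ)) : ℂ) + (η : ℂ) * Complex.I)))).im| ≤ 2 / 5 ∧ |((2 / 3 * deriv Wc (((-(7 / 10 : ℝ)) : ℂ) + (η : ℂ) * Complex.I) + 2 * Wc (((-(7 / 10 : ℝ)) : ℂ) + (η : ℂ) * Complex.I) - r + 2 * deriv Sc (((-(7 / 10 : ℝ)) : ℂ) + (η : ℂ) * Complex.I) + 4 * Sc (((-(7 / 10 : ℝ)) : ℂ) + (η : ℂ) * Complex.I)) / (Wc (((-(7 / 10 : ℝ)) : ℂ) + (η : ℂ) * Complex.I)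 - 1 + Sc (((-(7 / 10 : ℝ)) : ℂ) + (η : ℂ) * Complex.I)) - (2 / 3 * deriv Wc (((-(7 / 10 : ℝ)) : ℂ) + (η : ℂ) * Complex.I) + 2 * Wc (((-(7 / 10 : ℝ)) : ℂ) + (η : ℂ) * Complex.I) - r - 2 * deriv Sc (((-(7 / 10 : ℝ)) : ℂ) + (η : ℂ) * Complex.I) - 4 * Sc (((-(7 / 10 : ℝ)) : ℂ) + (η : ℂ) * Complex.I)) / (Wc (((-(7 / 10 : ℝ)) : ℂ) + (η : ℂ) * Complex.I) - 1 - Sc (((-(7 / 10 : ℝ)) : ℂ) + (η : ℂ) * Complex.I))).im| ≤ 2 / 5) → (∀ k : Fin 12, ∀ s : ℝ, 0 ≤ s → s ≤ 1 → (0 ≤ (-(((A k.succ - A k.castSucc)) * (1 / (Wc (A k.castSucc + (s : ℂ) * (A k.succ - A k.castSucc)) - 1 + Sc (A k.castSucc + (s : ℂ) * (A k.succ - A k.castSucc))) - 1 / (Wc (A k.castSucc + (s : ℂ) * (A k.succ - A k.castSucc)) - 1 - Sc (A k.castSucc + (s : ℂ) * (A k.succ - A k.castSucc))))).im) ∧ 1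 ≤ 1000 * (-(((A k.succ - A k.castSucc)) * (1 / (Wc (A k.castSucc + (s : ℂ) * (A k.succ - A k.castSucc)) - 1 + Sc (A k.castSucc + (s : ℂ) * (A k.succ - A k.castSucc))) - 1 / (Wc (A k.castSucc + (s : ℂ) * (A k.succ - A k.castSucc)) - 1 - Sc (A k.castSucc + (s : ℂ) * (A k.succ - A k.castSucc))))).im) - ((((A k.succ - A k.castSucc)) * (1 / (Wc (A k.castSucc + (s : ℂ) * (A k.succ - A k.castSucc)) - 1 + Sc (A k.castSucc + (s : ℂ) * (A k.succ - A k.castSucc))) - 1 / (Wc (A k.castSucc + (s : ℂ) * (A k.succ - A k.castSucc)) - 1 - Sc (A k.castSucc + (s : ℂ) * (A k.succ - A k.castSucc))))).re) / 4 + ((-((2 / 3 * deriv Wc (A k.castSucc + (s : ℂ) * (A k.succ - A k.castSucc)) + 2 * Wc (A k.castSucc + (s : ℂ) * (A k.succ - A k.castSucc)) - r + 2 * deriv Sc (A k.castSucc + (s : ℂ) * (A k.succ - A k.castSucc)) + 4 * Sc (A k.castSucc + (s : ℂ) * (A k.succ - A k.castSucc))) * ((A k.succ - A k.castSucc)) /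 (Wc (A k.castSucc + (s : ℂ) * (A k.succ - A k.castSucc)) - 1 + Sc (A k.castSucc + (s : ℂ) * (A k.succ - A k.castSucc)))) + (2 / 3 * deriv Wc (A k.castSucc + (s : ℂ) * (A k.succ - A k.castSucc)) + 2 * Wc (A k.castSucc + (s : ℂ) * (A k.succ - A k.castSucc)) - r - 2 * deriv Sc (A k.castSucc + (s : ℂ) * (A k.succ - A k.castSucc)) - 4 * Sc (A k.castSucc + (s : ℂ) * (A k.succ - A k.castSucc))) * ((A k.succ - A k.castSucc)) / (Wc (A k.castSucc + (s : ℂ) * (A k.succ - A k.castSucc)) - 1 - Sc (A k.castSucc + (s : ℂ) * (A k.succ - A k.castSucc)))).re) ∧ 1 ≤ 1000 * (-(((A k.succ - A k.castSucc)) * (1 / (Wc (A k.castSucc + (s : ℂ) * (A k.succ - A k.castSucc)) - 1 + Sc (A k.castSucc + (s : ℂ) * (A k.succ - A k.castSucc))) - 1 / (Wc (A k.castSucc + (s : ℂ) * (A k.succ - A k.castSucc)) - 1 - Sc (A k.castSucc + (s : ℂ) * (A k.succ - A k.castSucc))))).im) + 3 * ((((A k.succ - A k.castSucc)) * (1 /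 (Wc (A k.castSucc + (s : ℂ) * (A k.succ - A k.castSucc)) - 1 + Sc (A k.castSucc + (s : ℂ) * (A k.succ - A k.castSucc))) - 1 / (Wc (A k.castSucc + (s : ℂ) * (A k.succ - A k.castSucc)) - 1 - Sc (A k.castSucc + (s : ℂ) * (A k.succ - A k.castSucc))))).re) + ((-((2 / 3 * deriv Wc (A k.castSucc + (s : ℂ) * (A k.succ - A k.castSucc)) + 2 * Wc (A k.castSucc + (s : ℂ) * (A k.succ - A k.castSucc)) - r + 2 * deriv Sc (A k.castSucc + (s : ℂ) * (A k.succ - A k.castSucc)) + 4 * Sc (A k.castSucc + (s : ℂ) * (A k.succ - A k.castSucc))) * ((A k.succ - A k.castSucc)) / (Wc (A k.castSucc + (s : ℂ) * (A k.succ - A k.castSucc)) - 1 + Sc (A k.castSucc + (s : ℂ) * (A k.succ - A k.castSucc)))) + (2 / 3 * deriv Wc (A k.castSucc + (s : ℂ) * (A k.succ - A k.castSucc)) + 2 * Wc (A k.castSucc + (s : ℂ) * (A k.succ - A k.castSucc)) - r - 2 * deriv Sc (A k.castSucc + (s : ℂ) * (A k.succ - A k.castSucc)) - 4 * Sc (A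 k.castSucc + (s : ℂ) * (A k.succ - A k.castSucc))) * ((A k.succ - A k.castSucc)) / (Wc (A k.castSucc + (s : ℂ) * (A k.succ - A k.castSucc)) - 1 - Sc (A k.castSucc + (s : ℂ) * (A k.succ - A k.castSucc)))).re))) → SonicSlaving r W S := by
  intro r W S Wc Sc A hr1 hr2 hP hT hWc hSc htr hcm1 hcp3 hA hL hV hG
  refine sonicSlaving_of_pos_im r W S fun Λ ŵ ŝ hmode hre hside hIm => ?_
  -- the rate range
  have hI : 1000 ≤ Λ.im := by
    have : (1000 : ℝ) < Λ.im := by simpa [boxTop] using hIm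
    exact this.le
  have hL0 : (0 : ℝ) < Λ.im := by linarith
  have hR2 : Λ.re ≤ 3 := realBound_three r W S Λ ŵ ŝ hP hT hmode
  have hR1 : -(1 / 4 : ℝ) ≤ Λ.re := hre.le
  have hΛim : Λ.im ≠ 0 := hL0.ne'
  -- the complex speeds do not vanish on the punctured wedge
  have hcpW : ∀ z ∈ sonicWedge, z ≠ 0 → (Wc z - 1 + Sc z) ≠ 0 := fun z hz h0 =>
    norm_pos_iff.1 ((mul_pos (by norm_num) (norm_pos_iff.2 h0)).trans_le (hcp3 z hz))
  have hcmW : ∀ z ∈ sonicWedge, (Wc z - 1 - Sc z) ≠ 0 := fun z hz => norm_pos_iff.1 (lt_of_lt_of_le one_pos (hcm1 z hz))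
  -- the holomorphic characteristic pair on the wedge
  obtain ⟨P, M, hPd, hMd, htrPM, hsys⟩ := smoothMode_wedge_continuation r W S Wc Sc Λ ŵ ŝ hP hT hWc hSc htr hcpW hcmW hΛim hmode
  -- the contour
  obtain ⟨A', hA', y, dy, hyc, hdyc, hder, hy0, hy12, hfacts, hleg, hint1, hint12, hedge⟩ := exists_sonicLoop
  have hAA : A = A' := hA.trans hA'.symm
  subst hAA
  -- the phase: a holomorphic primitive of `(Λ − b₋₋)/c₋` on the wedge
  have hHd : DifferentiableOn ℂ (fun z => ((Λ - (2 / 3 * deriv Wc z + 2 * Wc z - r - 2 * deriv Sc z - 4 * Sc z)) / (Wc z - 1 - Sc z))) sonicWedge := by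
    have hWd' := differentiableOn_deriv_sonicWedge hWc
    have hSd' := differentiableOn_deriv_sonicWedge hSc
    exact ((differentiableOn_const Λ).sub (((((hWd'.const_mul _).add (hWc.const_mul _)).sub_const _).sub (hSd'.const_mul _)).sub
      (hSc.const_mul _))).div ((hWc.sub_const 1).sub hSc) hcmW
  obtain ⟨Θ, hΘ⟩ : ∃ Θ : ℂ → ℂ, ∀ z ∈ sonicWedge, HasDerivAt Θ (((Λ - (2 / 3 * deriv Wc z + 2 * Wc z - r - 2 * deriv Sc z - 4 * Sc z)) / (Wc z - 1 - Sc z))) z :=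
    ⟨_, fun z hz => Literature.Analysis.ODE.hasDerivAt_rayPrimitive (H := fun z => ((Λ - (2 / 3 * deriv Wc z + 2 * Wc z - r - 2 * deriv Sc z - 4 * Sc z)) / (Wc z - 1 - Sc z))) isOpen_sonicWedge starConvex_sonicWedge hHd hz⟩
  -- the gauge functions and the coefficients along the contour
  set g : ℝ → ℂ := fun s => Complex.exp (-Θ (y s)) * (P (y s) - ((deriv Wc (y s) / 3 + deriv Sc (y s) + 2 * Sc (y s)) / ((Λ - (2 / 3 * deriv Wc (y s) + 2 * Wc (y s) - r + 2 * deriv Sc (y s) + 4 * Sc (y s))) - (Wc (y s) - 1 + Sc (y s)) / (Wc (y s) - 1 - Sc (y s)) * (Λ - (2 / 3 * deriv Wc (y s) + 2 * Wc (y s) - r - 2 * deriv Sc (y s) - 4 * Sc (y s))))) * M (y s)) with hg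
  set υ : ℝ → ℂ := fun s => Complex.exp (-Θ (y s)) * M (y s) with hυ
  set a : ℝ → ℂ := fun σ => dy σ * ((Λ - (2 / 3 * deriv Wc (y σ) + 2 * Wc (y σ) - r + 2 * deriv Sc (y σ) + 4 * Sc (y σ))) / (Wc (y σ) - 1 + Sc (y σ)) - (Λ - (2 / 3 * deriv Wc (y σ) + 2 * Wc (y σ) - r - 2 * deriv Sc (y σ) - 4 * Sc (y σ))) / (Wc (y σ) - 1 - Sc (y σ))) - dy σ * (-(deriv Wc (y σ) / 3 - deriv Sc (y σ) - 2 * Sc (y σ)) / (Wc (y σ) - 1 - Sc (y σ))) * ((deriv Wc (y σ) / 3 + deriv Sc (y σ) + 2 * Sc (y σ)) / ((Λ - (2 / 3 * deriv Wc (y σ) + 2 * Wc (y σ) - r + 2 * deriv Sc (y σ) + 4 * Sc (y σ))) - (Wc (y σ) - 1 + Sc (y σ)) / (Wc (y σ) - 1 - Sc (y σ)) * (Λ - (2 / 3 * deriv Wc (y σ) + 2 * Wc (y σ) - r - 2 * deriv Sc (y σ) - 4 * Sc (y σ))))) with ha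
  set f : ℝ → ℂ := fun σ => dy σ * (((deriv (deriv Wc) (y σ) / 3 + deriv (deriv Sc) (y σ) + 2 * deriv Sc (y σ)) * ((Λ - (2 / 3 * deriv Wc (y σ) + 2 * Wc (y σ) - r + 2 * deriv Sc (y σ) + 4 * Sc (y σ))) - (Wc (y σ) - 1 + Sc (y σ)) / (Wc (y σ) - 1 - Sc (y σ)) * (Λ - (2 / 3 * deriv Wc (y σ) + 2 * Wc (y σ) - r - 2 * deriv Sc (y σ) - 4 * Sc (y σ)))) - (deriv Wc (y σ) / 3 + deriv Sc (y σ) + 2 * Sc (y σ)) * (-(2 / 3 * deriv (deriv Wc) (y σ) + 2 * deriv Wc (y σ) + 2 * deriv (deriv Sc) (y σ) + 4 * deriv Sc (y σ)) - ((deriv Wc (y σ) + deriv Sc (y σ)) / (Wc (y σ) - 1 - Sc (y σ)) - (Wc (y σ) - 1 + Sc (y σ)) * (deriv Wc (y σ) - deriv Sc (y σ)) / (Wc (y σ) - 1 - Sc (y σ)) ^ 2) * (Λ - (2 / 3 * deriv Wc (y σ) + 2 * Wc (y σ) - r - 2 * deriv Sc (y σ) - 4 * Sc (y σ))) + ((Wc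 (y σ) - 1 + Sc (y σ)) / (Wc (y σ) - 1 - Sc (y σ))) * (2 / 3 * deriv (deriv Wc) (y σ) + 2 * deriv Wc (y σ) - 2 * deriv (deriv Sc) (y σ) - 4 * deriv Sc (y σ)))) / ((Λ - (2 / 3 * deriv Wc (y σ) + 2 * Wc (y σ) - r + 2 * deriv Sc (y σ) + 4 * Sc (y σ))) - (Wc (y σ) - 1 + Sc (y σ)) / (Wc (y σ) - 1 - Sc (y σ)) * (Λ - (2 / 3 * deriv Wc (y σ) + 2 * Wc (y σ) - r - 2 * deriv Sc (y σ) - 4 * Sc (y σ)))) ^ 2) + dy σ * (-(deriv Wc (y σ) / 3 - deriv Sc (y σ) - 2 * Sc (y σ)) / (Wc (y σ) - 1 - Sc (y σ))) * ((deriv Wc (y σ) / 3 + deriv Sc (y σ) + 2 * Sc (y σ)) / ((Λ - (2 / 3 * deriv Wc (y σ) + 2 * Wc (y σ) - r + 2 * deriv Sc (y σ) + 4 * Sc (y σ))) - (Wc (y σ) - 1 + Sc (y σ)) / (Wc (y σ) - 1 - Sc (y σ)) * (Λ - (2 / 3 * deriv Wc (y σ) + 2 * Wc (y σ) - r - 2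 * deriv Sc (y σ) - 4 * Sc (y σ))))) ^ 2 with hf
  set αp : ℝ → ℂ := fun σ => dy σ * (-(deriv Wc (y σ) / 3 - deriv Sc (y σ) - 2 * Sc (y σ)) / (Wc (y σ) - 1 - Sc (y σ))) with hαp
  set ρp : ℝ → ℂ := fun σ => ((deriv Wc (y σ) / 3 + deriv Sc (y σ) + 2 * Sc (y σ)) / ((Λ - (2 / 3 * deriv Wc (y σ) + 2 * Wc (y σ) - r + 2 * deriv Sc (y σ) + 4 * Sc (y σ))) - (Wc (y σ) - 1 + Sc (y σ)) / (Wc (y σ) - 1 - Sc (y σ)) * (Λ - (2 / 3 * deriv Wc (y σ) + 2 * Wc (y σ) - r - 2 * deriv Sc (y σ) - 4 * Sc (y σ))))) with hρp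
  -- the pointwise package along the contour
  have hpt : ∀ σ ∈ Icc (0 : ℝ) 12, y σ ∈ sonicWedge ∧ (Wc (y σ) - 1 + Sc (y σ)) ≠ 0 ∧ (Wc (y σ) - 1 - Sc (y σ)) ≠ 0 ∧ ((Λ - (2 / 3 * deriv Wc (y σ) + 2 * Wc (y σ) - r + 2 * deriv Sc (y σ) + 4 * Sc (y σ))) - (Wc (y σ) - 1 + Sc (y σ)) / (Wc (y σ) - 1 - Sc (y σ)) * (Λ - (2 / 3 * deriv Wc (y σ) + 2 * Wc (y σ) - r - 2 * deriv Sc (y σ) - 4 * Sc (y σ)))) ≠ 0 ∧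
      ‖ρp σ‖ ≤ 400 / (127 * Λ.im) ∧ 0 ≤ (a σ).re ∧ ‖f σ‖ ≤ 25 / 4 / Λ.im * ‖dy σ‖ ∧ ‖αp σ‖ ≤ 4 / 5 * ‖dy σ‖ := by
    intro σ hσ
    obtain ⟨hzW, hz0, hreg, k, s, hs, c, hc, ez, edy⟩ := hfacts σ hσ
    have hcp := hcpW _ hzW hz0
    have hcm := hcmW _ hzW
    have hLz := hL (y σ) hreg
    have hgood := hG k s hs.1 hs.2
    rw [← ez] at hgood
    obtain ⟨hQ, hρ, hrea, hfb, hαb⟩ := contour_pointwise (r := r) (Wc := Wc) (Sc := Sc) (Λ := Λ) (z := y σ)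
      (τ := A k.succ - A k.castSucc) (c := c) hLz hgood (hedge k) hc hI hR1 hR2
    have hndy : ‖dy σ‖ = c * ‖A k.succ - A k.castSucc‖ := by
      rw [edy, norm_mul, Complex.norm_real, Real.norm_eq_abs, abs_of_nonneg hc]
    refine ⟨hzW, hcp, hcm, hQ, hρ, ?_, ?_, ?_⟩
    · simp only [ha]; rw [edy]; exact hrea
    · rw [hndy]; simp only [hf]; rw [edy]; exact hfb
    · rw [hndy]; simp only [hαp]; rw [edy]; exact hαb
  -- the slaved-gauge system along the contour
  have hsysp : ∀ σ ∈ Icc (0 : ℝ) 12, HasDerivAt g (a σ * g σ - f σ * υ σ) σ ∧ HasDerivAt υ (αp σ * (g σ + ρp σ * υ σ)) σ := by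
    intro σ hσ
    obtain ⟨hzW, hcp, hcm, hQ, -⟩ := hpt σ hσ
    have hPat : DifferentiableAt ℂ P (y σ) := hPd.differentiableAt (isOpen_sonicWedge.mem_nhds hzW)
    have hMat : DifferentiableAt ℂ M (y σ) := hMd.differentiableAt (isOpen_sonicWedge.mem_nhds hzW)
    have hρ' := hasDerivAt_charRho r Wc Sc Λ (y σ) hWc hSc hzW hcm hQ
    obtain ⟨h1, h2⟩ := path_slaved_gauge r Wc Sc P M Θ Λ y (dy σ) ((((deriv (deriv Wc) (y σ) / 3 + deriv (deriv Sc) (y σ) + 2 * deriv Sc (y σ)) * ((Λ - (2 / 3 * deriv Wc (y σ) + 2 * Wc (y σ) - r + 2 * deriv Sc (y σ) + 4 * Sc (y σ))) - (Wc (y σ) - 1 + Sc (y σ)) / (Wc (y σ) - 1 - Sc (y σ)) * (Λ - (2 / 3 * deriv Wc (y σ) + 2 * Wc (y σ) - r - 2 * deriv Sc (y σ) - 4 * Sc (y σ)))) - (deriv Wc (y σ) / 3 + deriv Sc (y σ) + 2 * Sc (y σ)) * (-(2 / 3 * deriv (deriv Wc) (y σ) + 2 * deriv Wc (y σ) + 2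 * deriv (deriv Sc) (y σ) + 4 * deriv Sc (y σ)) - ((deriv Wc (y σ) + deriv Sc (y σ)) / (Wc (y σ) - 1 - Sc (y σ)) - (Wc (y σ) - 1 + Sc (y σ)) * (deriv Wc (y σ) - deriv Sc (y σ)) / (Wc (y σ) - 1 - Sc (y σ)) ^ 2) * (Λ - (2 / 3 * deriv Wc (y σ) + 2 * Wc (y σ) - r - 2 * deriv Sc (y σ) - 4 * Sc (y σ))) + ((Wc (y σ) - 1 + Sc (y σ)) / (Wc (y σ) - 1 - Sc (y σ))) * (2 / 3 * deriv (deriv Wc) (y σ) + 2 * deriv Wc (y σ) - 2 * deriv (deriv Sc) (y σ) - 4 * deriv Sc (y σ)))) / ((Λ - (2 / 3 * deriv Wc (y σ) + 2 * Wc (y σ) - r + 2 * deriv Sc (y σ) + 4 * Sc (y σ))) - (Wc (y σ) - 1 + Sc (y σ)) / (Wc (y σ) - 1 - Sc (y σ)) * (Λ - (2 / 3 * deriv Wc (y σ) + 2 * Wc (y σ) - r - 2 * deriv Sc (y σ) - 4 * Sc (y σ)))) ^ 2)) σ (hder σ) hPat hMat (hsys _ hzW).1 (hsys _ hzW).2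
      hcp hcm hQ (hΘ _ hzW) hρ'
    exact ⟨h1.congr_deriv (by simp only [hg, hυ, ha, hf]), h2.congr_deriv (by simp only [hg, hυ, hαp, hρp])⟩
  -- continuity of the coefficients along the contour
  have hcont : ContinuousOn a (Icc 0 12) ∧ ContinuousOn f (Icc 0 12) ∧ ContinuousOn αp (Icc 0 12) ∧ ContinuousOn ρp (Icc 0 12) := by
    have key : ∀ σ ∈ Icc (0 : ℝ) 12, ContinuousAt a σ ∧ ContinuousAt f σ ∧ ContinuousAt αp σ ∧ ContinuousAt ρp σ := by
      intro σ hσ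
      obtain ⟨hzW, hcp, hcm, hQ, -⟩ := hpt σ hσ
      obtain ⟨dQs, dα, dρ, dρ', -⟩ := differentiableAt_charCoeffs (r := r) (Λ := Λ) hWc hSc hzW hcp hcm hQ
      have cQs := (hasDerivAt_comp_realPath dQs.hasDerivAt (hder σ)).continuousAt
      have cα := (hasDerivAt_comp_realPath dα.hasDerivAt (hder σ)).continuousAt
      have cρ := (hasDerivAt_comp_realPath dρ.hasDerivAt (hder σ)).continuousAt
      have cρ' := (hasDerivAt_comp_realPath dρ'.hasDerivAt (hder σ)).continuousAt
      have cdy : ContinuousAt dy σ := hdyc.continuousAt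
      exact ⟨(cdy.mul cQs).sub ((cdy.mul cα).mul cρ), (cdy.mul cρ').add ((cdy.mul cα).mul (cρ.pow 2)), cdy.mul cα, cρ⟩
    exact ⟨fun σ hσ => (key σ hσ).1.continuousWithinAt, fun σ hσ => (key σ hσ).2.1.continuousWithinAt,
      fun σ hσ => (key σ hσ).2.2.1.continuousWithinAt, fun σ hσ => (key σ hσ).2.2.2.continuousWithinAt⟩
  -- the primitive of `a` (extended continuously by clamping the parameter)
  set cl : ℝ → ℝ := fun σ => max 0 (min σ 12) with hcl
  have hclc : Continuous cl := continuous_const.max (continuous_id.min continuous_const)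
  have hclI : ∀ σ, cl σ ∈ Icc (0 : ℝ) 12 := fun σ => ⟨le_max_left _ _, max_le (by norm_num) (min_le_right _ _)⟩
  have hclid : ∀ σ ∈ Icc (0 : ℝ) 12, cl σ = σ := fun σ hσ => by
    simp only [hcl]; rw [min_eq_left hσ.2, max_eq_right hσ.1]
  set ac : ℝ → ℂ := fun σ => a (cl σ) with hac
  have hacc : Continuous ac := hcont.1.comp_continuous hclc hclI
  set Ai : ℝ → ℂ := fun σ => ∫ τ in (0 : ℝ)..σ, ac τ with hAi
  have hAi' : ∀ σ ∈ Icc (0 : ℝ) 12, HasDerivAt Ai (a σ) σ := by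
    intro σ hσ
    have h := intervalIntegral.integral_hasDerivAt_right (hacc.intervalIntegrable 0 σ) (hacc.stronglyMeasurableAtFilter volume (𝓝 σ))
      hacc.continuousAt
    have e : ac σ = a σ := by simp only [hac, hclid σ hσ]
    rw [e] at h
    exact h
  have hA0 : Ai 0 = 0 := by simp [hAi]
  have hloop : g 12 = g 0 := by simp only [hg, hy12, hy0]
  -- the first leg: steepness and the forcing
  have hleg' : ∀ σ ∈ Icc (0 : ℝ) 1, 1598 * ‖dy σ‖ ≤ (a σ).re ∧ ‖f σ‖ ≤ 25 / 4 / Λ.im * ‖dy σ‖ := by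
    intro σ hσ
    have hσ' : σ ∈ Icc (0 : ℝ) 12 := ⟨hσ.1, hσ.2.trans (by norm_num)⟩
    obtain ⟨hzW, hcp, hcm, hQ, -, -, hfb, -⟩ := hpt σ hσ'
    obtain ⟨c, hc, edy, η, hη, ey⟩ := hleg σ hσ
    obtain ⟨hzW', -, hreg, -⟩ := hfacts σ hσ'
    have hLz := hL (y σ) hreg
    obtain ⟨hV1, hV2, hV3⟩ := hV η hη
    rw [← ey] at hV1 hV2 hV3
    have hst := contour_pointwise_vertical (r := r) (Wc := Wc) (Sc := Sc) (Λ := Λ) (z := y σ) (c := c) hLz hV1 hV2 hV3 hc hI hR1 hR2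
    have hndy : ‖dy σ‖ = c * (189 / 2000) := by
      rw [edy, norm_mul, norm_mul, norm_neg, Complex.norm_real, Complex.norm_real, Complex.norm_I, Real.norm_eq_abs, Real.norm_eq_abs,
        abs_of_nonneg hc, abs_of_pos (by norm_num : (0 : ℝ) < 189 / 2000), mul_one]
    refine ⟨?_, hfb⟩
    rw [hndy]
    simp only [ha]
    rw [edy]
    exact hst
  have hL₀ : 1598 * (189 / 2000) ≤ (Ai 1).re := by
    have e : (Ai 1).re = ∫ τ in (0 : ℝ)..1, (ac τ).re := by
      have := intervalIntegral.intervalIntegral_re (μ := volume) (hacc.intervalIntegrable 0 1)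
      simp only [RCLike.re_to_complex] at this
      exact this.symm
    rw [e, ← hint1, ← intervalIntegral.integral_const_mul]
    refine intervalIntegral.integral_mono_on zero_le_one ((continuous_const.mul hdyc.norm).intervalIntegrable _ _)
      ((Complex.continuous_re.comp hacc).intervalIntegrable _ _) fun τ hτ => ?_
    have e2 : ac τ = a τ := by simp only [hac, hclid τ ⟨hτ.1, hτ.2.trans (by norm_num)⟩]
    rw [e2]
    exact (hleg' τ hτ).1
  -- the budgets
  have hfc : ContinuousOn (fun σ => ‖f σ‖) (Icc 0 12) := hcont.2.1.norm
  have hαc : ContinuousOn (fun σ => ‖αp σ‖) (Icc 0 12) := hcont.2.2.1.norm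
  have hIf : ∫ σ in (0 : ℝ)..12, ‖f σ‖ ≤ 25 / 2 / Λ.im := by
    calc ∫ σ in (0 : ℝ)..12, ‖f σ‖ ≤ ∫ σ in (0 : ℝ)..12, 25 / 4 / Λ.im * ‖dy σ‖ :=
          intervalIntegral.integral_mono_on (by norm_num) (hfc.mono (by rw [uIcc_of_le (by norm_num)])).intervalIntegrable
            ((continuous_const.mul hdyc.norm).intervalIntegrable _ _) fun σ hσ => (hpt σ hσ).2.2.2.2.2.2.1
      _ = 25 / 4 / Λ.im * ∫ σ in (0 : ℝ)..12, ‖dy σ‖ := intervalIntegral.integral_const_mul _ _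
      _ ≤ 25 / 4 / Λ.im * 2 := mul_le_mul_of_nonneg_left hint12 (by positivity)
      _ = 25 / 2 / Λ.im := by ring
  have hΦ : ∫ σ in (1 : ℝ)..12, ‖f σ‖ ≤ 25 / 2 / Λ.im := by
    refine le_trans ?_ hIf
    exact intervalIntegral.integral_mono_interval zero_le_one (by norm_num) le_rfl (Eventually.of_forall fun σ => norm_nonneg _)
      ((hfc.mono (by rw [uIcc_of_le (by norm_num)])).intervalIntegrable)
  have hAα : ∫ σ in (0 : ℝ)..12, ‖αp σ‖ ≤ 8 / 5 := by
    calc ∫ σ in (0 : ℝ)..12, ‖αp σ‖ ≤ ∫ σ in (0 : ℝ)..12, 4 / 5 * ‖dy σ‖ :=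
          intervalIntegral.integral_mono_on (by norm_num) (hαc.mono (by rw [uIcc_of_le (by norm_num)])).intervalIntegrable
            ((continuous_const.mul hdyc.norm).intervalIntegrable _ _) fun σ hσ => (hpt σ hσ).2.2.2.2.2.2.2
      _ = 4 / 5 * ∫ σ in (0 : ℝ)..12, ‖dy σ‖ := intervalIntegral.integral_const_mul _ _
      _ ≤ 4 / 5 * 2 := mul_le_mul_of_nonneg_left hint12 (by positivity)
      _ = 8 / 5 := by norm_num
  -- THE LOOP ESTIMATE
  have key := Literature.Analysis.ODE.loop_slaving_estimate (T := 12) (s₁ := 1) (lam := 1598) (f₁ := 25 / 4 / Λ.im)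
    (L₀ := 1598 * (189 / 2000)) (Φ := 25 / 2 / Λ.im) (Φ' := 25 / 2 / Λ.im) (Aα := 8 / 5) (ϱ := 400 / (127 * Λ.im))
    (g := g) (υ := υ) (a := a) (f := f) (α := αp) (ρ := ρp) (A := Ai) (v := fun σ => ‖dy σ‖) (by norm_num)
    (fun σ hσ => (hsysp σ hσ).1) (fun σ hσ => (hsysp σ hσ).2) hAi' hcont.1 hcont.2.1 hcont.2.2.1 hcont.2.2.2 hA0 hloop
    (fun σ hσ => (hpt σ hσ).2.2.2.2.2.1) ⟨by norm_num, by norm_num⟩ (by norm_num) (by positivity)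
    (fun σ hσ => (hleg' σ hσ).1) (fun σ hσ => (hleg' σ hσ).2) hL₀ (by norm_num) hΦ hIf hAα (fun σ hσ => (hpt σ hσ).2.2.2.2.1)
  -- the base values: `g 0 = e^{−Θ(x_m)} D`, `υ 0 = e^{−Θ(x_m)} m(x_m)`
  obtain ⟨-, -, hWsm, hSsm, -, -⟩ := id hP
  have hWr : Differentiable ℝ W := hWsm.differentiable (by simp)
  have hSr : Differentiable ℝ S := hSsm.differentiable (by simp)
  have hm1 : -(4 / 5 : ℝ) < matchPoint := by norm_num [matchPoint]
  have hm2 : matchPoint < 1 / 20 := by norm_num [matchPoint]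
  have hxm : ((matchPoint : ℝ) : ℂ) = ((-(7 / 10 : ℝ)) : ℂ) := by norm_num [matchPoint]
  obtain ⟨eW, eS⟩ := htr matchPoint hm1 hm2
  have edW := deriv_continuation_ofReal hWc hWr (fun x h1 h2 => (htr x h1 h2).1) hm1 hm2
  have edS := deriv_continuation_ofReal hSc hSr (fun x h1 h2 => (htr x h1 h2).2) hm1 hm2
  obtain ⟨ePm, eMm⟩ := htrPM matchPoint hm1 hm2
  rw [hxm] at eW eS edW edS ePm eMm
  have hρm : ((deriv Wc (((-(7 / 10 : ℝ)) : ℂ)) / 3 + deriv Sc (((-(7 / 10 : ℝ)) : ℂ)) + 2 * Sc (((-(7 / 10 : ℝ)) : ℂ))) / ((Λ - (2 / 3 * deriv Wc (((-(7 / 10 : ℝ)) : ℂ)) + 2 * Wc (((-(7 / 10 : ℝ)) : ℂ)) - r + 2 * deriv Sc (((-(7 / 10 : ℝ)) : ℂ)) + 4 * Sc (((-(7 / 10 : ℝ)) : ℂ)))) - (Wc (((-(7 / 10 : ℝ)) : ℂ)) - 1 + Sc (((-(7 / 10 : ℝ)) : ℂ))) / (Wc (((-(7 / 10 : ℝ))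 : ℂ)) - 1 - Sc (((-(7 / 10 : ℝ)) : ℂ))) * (Λ - (2 / 3 * deriv Wc (((-(7 / 10 : ℝ)) : ℂ)) + 2 * Wc (((-(7 / 10 : ℝ)) : ℂ)) - r - 2 * deriv Sc (((-(7 / 10 : ℝ)) : ℂ)) - 4 * Sc (((-(7 / 10 : ℝ)) : ℂ)))))) = slavingCoeff r W S Λ matchPoint := by
    unfold slavingCoeff
    rw [eW, eS, edW, edS]
    push_cast
    ring
  have hg0 : g 0 = Complex.exp (-Θ (((-(7 / 10 : ℝ)) : ℂ))) * pWaveContent r W S Λ ŵ ŝ := by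
    simp only [hg, hy0]
    rw [hρm, ePm, eMm]
    rfl
  have hυ0 : υ 0 = Complex.exp (-Θ (((-(7 / 10 : ℝ)) : ℂ))) * (ŵ matchPoint - 3 * ŝ matchPoint) := by
    simp only [hυ, hy0]
    rw [eMm]
  rw [hg0, hυ0, norm_mul, norm_mul] at key
  -- the constants and the final arithmetic (on named reals)
  obtain ⟨hκ, hc1⟩ := contour_constants _ hI
  generalize hce : (25 / 4 / Λ.im / 1598 + Real.exp (-(1598 * (189 / 2000))) * (25 / 2 / Λ.im)) /
    (1 - Real.exp (-(1598 * (189 / 2000)))) = c1 at key hc1 hκ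
  generalize hke : 1 - 8 / 5 * (c1 + 25 / 2 / Λ.im + 400 / (127 * Λ.im)) = k at key hc1 hκ
  generalize hEe : ‖Complex.exp (-Θ (((-(7 / 10 : ℝ)) : ℂ)))‖ = E at key
  have hE0 : 0 < E := by rw [← hEe]; exact norm_pos_iff.2 (Complex.exp_ne_zero _)
  rw [abs_of_pos hL0]
  generalize hDe : ‖pWaveContent r W S Λ ŵ ŝ‖ = D at key ⊢
  generalize hMe : ‖ŵ matchPoint - 3 * ŝ matchPoint‖ = Mm at key ⊢
  have hD0 : 0 ≤ D := by rw [← hDe]; exact norm_nonneg _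
  have hMm0 : 0 ≤ Mm := by rw [← hMe]; exact norm_nonneg _
  have h1 : E * (D * k) ≤ E * (c1 * Mm) := by nlinarith [key]
  have h2 : D * k ≤ c1 * Mm := le_of_mul_le_mul_left h1 hE0
  have h3 : Λ.im * (D * k) ≤ Λ.im * (c1 * Mm) := mul_le_mul_of_nonneg_left h2 hL0.le
  have h4 : Λ.im * (c1 * Mm) ≤ 2 * k * Mm := by nlinarith [mul_le_mul_of_nonneg_right hc1 hMm0]
  nlinarith

end Summit.AtomisticToContinuum.HydrodynamicLimit.Theorems.SonicCavityRenewal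

end
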